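import Literature.NumberTheory.EllipticCurves.BSDSelmer
import Literature.NumberTheory.EllipticCurves.SelmerProofs
import Literature.NumberTheory.EllipticCurves.SelmerCorankHolds
import HarnessLib

/-!
# bsd.S11: discharge of the Selmer-group facts of `Literature.NumberTheory.EllipticCurves.BSDSelmer`

D-0014 keeps `Literature/` sorry-free by stating cited results as named facts `def X : Prop`.
The bsd.S11 block of `BSDSelmer` restates, for a Weierstrass curve `W` over a number field `K`,
three facts of the `Selmer` prelude whose interim proofs were one-line appeals to prelude
theorems that were themselves named facts at the time of the D-0014 sweep (proofs preserved there
in comments). All three prelude facts are now theorems of the tree, so the bsd.S11 facts are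
discharged here verbatim along the preserved proofs:

* `map_torsionH1ToH1_selmerGroup_holds` — `Sel^(n)(E/K) ↠ Ш(E/K)[n]` for `n ≠ 0` (Silverman,
  *AEC*, Thm. X.4.2(a)), from `WeierstrassCurve.map_torsionH1ToH1_selmerGroup_holds`
  (`SelmerProofs`: `Sel^(n)` is the preimage of `Ш`, Kummer surjectivity on continuous cochains,
  `n`-divisibility of `E(K̄)`);
* `selmer_exact_holds` — the fundamental exact sequence
  `0 → E(K)/nE(K) → Sel^(n)(E/K) → Ш(E/K)[n] → 0` (ibid.), from
  `WeierstrassCurve.exists_kummerMap_holds` and the previous theorem;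
* `selmerCorank_eq_holds` — `corank_{ℤ_p} Sel_{p^∞}(E/K) = rank E(K) + corank_{ℤ_p} Ш(E/K)[p^∞]`
  (Greenberg, LNM 1716 (1999), §1, pp. 54–57), from
  `WeierstrassCurve.selmerCorank_eq_mordellWeilRank_add_holds` (`SelmerCorankHolds`: the `p^∞`
  Kummer sequence, Mordell–Weil, finiteness of the `n`-Selmer groups).

Only theorems are added; no definition and no statement of `BSDSelmer` is changed. (The bsd.S19
facts of the same file are treated in `BSDSelmerParityProofs` / `BSDSelmerParityDokchitserProofs`.)

## References

* [SilvermanAEC2009] J. H. Silverman, *The Arithmetic of Elliptic Curves*, 2nd ed., GTM 106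
  (2009): §VIII.2 and Thm. X.4.2(a).
* [Greenberg1999LNM] R. Greenberg, *Iwasawa theory for elliptic curves*, LNM 1716 (1999), §1,
  pp. 54–57.
-/

noncomputable section

universe u

namespace Literature.NumberTheory.EllipticCurves

variable {K : Type u} [Field K] [NumberField K] (W : WeierstrassCurve K)

/-- **Discharge of bsd.S11 `map_torsionH1ToH1_selmerGroup`** (Silverman, *AEC*, Thm. X.4.2(a):
for `n ≠ 0` the image of `Sel^(n)(E/K)` under `H¹(K, E[n]) → H¹(K, E)` is `Ш(E/K)[n]`): the body
is that of the prelude fact `WeierstrassCurve.map_torsionH1ToH1_selmerGroup W`, proved in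
`SelmerProofs` as `WeierstrassCurve.map_torsionH1ToH1_selmerGroup_holds` (no `IsElliptic`
hypothesis: singular cubics are covered by Prop. III.2.5). [cite: SilvermanAEC2009, Thm X.4.2(a)] -/
theorem map_torsionH1ToH1_selmerGroup_holds : map_torsionH1ToH1_selmerGroup W :=
  fun hn ↦ WeierstrassCurve.map_torsionH1ToH1_selmerGroup_holds W hn

/-- **Discharge of bsd.S11 `selmer_exact`** (the fundamental exact sequence
`0 → E(K)/nE(K) → Sel^(n)(E/K) → Ш(E/K)[n] → 0` for `n ≠ 0`; Silverman, *AEC*, §VIII.2 and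
Thm. X.4.2(a)): the Kummer map with kernel `nE(K)` and image `Sel^(n) ∩ ker (H¹(K, E[n]) → H¹(K, E))`
is `WeierstrassCurve.exists_kummerMap_holds` (`SelmerProofs`), and the surjection onto `Ш[n]` is
`map_torsionH1ToH1_selmerGroup_holds`; this is the interim proof preserved in `BSDSelmer`.
[cite: SilvermanAEC2009, §VIII.2 and Thm X.4.2(a)] -/
theorem selmer_exact_holds : selmer_exact W := by
  intro n hn
  obtain ⟨κ, h₁, h₂⟩ := WeierstrassCurve.exists_kummerMap_holds W hn
  exact ⟨κ, h₁, h₂, WeierstrassCurve.map_torsionH1ToH1_selmerGroup_holds W hn⟩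

/-- **Discharge of bsd.S11 `selmerCorank_eq`** (Greenberg, LNM 1716 (1999), §1, pp. 54–57: for an
elliptic curve `E` over a number field `K` and a prime `p`,
`corank_{ℤ_p} Sel_{p^∞}(E/K) = rank E(K) + corank_{ℤ_p} Ш(E/K)[p^∞]`): the body is that of the
prelude fact `WeierstrassCurve.selmerCorank_eq_mordellWeilRank_add W`, proved unconditionally in
`SelmerCorankHolds` as `WeierstrassCurve.selmerCorank_eq_mordellWeilRank_add_holds`; this is the
interim proof preserved in `BSDSelmer`. [cite: Greenberg1999LNM, §1 pp. 54–57] -/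
theorem selmerCorank_eq_holds : selmerCorank_eq W := by
  intro _ p _
  exact WeierstrassCurve.selmerCorank_eq_mordellWeilRank_add_holds W p

end Literature.NumberTheory.EllipticCurves

end
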